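import Mathlib
import HarnessLib
import Summits.ValiantsHypothesis.ValiantsHypothesis.Theorems.LacunarySymmetroidMatrixDescartesProductPlusOneLogWronskianSigns

/-!
# ValiantsHypothesis / LacunarySymmetroid — crux `MatrixDescartes` (stmt-ValiantsHypothesis-18050, V1),
# LINE (A) «product_plus_one», W-cells: the PURE BACKGROUND CELL at `K = 3` (brick W2, memo §21 `BackgroundCellK3`)

The company log-Wronskian `W(P) = P·X(XP′)′ − (XP′)²` of a product `P = ∏_j f_j` of `K = 3` rows `f_j = Σ_l C (a j l) X^{d l}` on a common
support `d 0 < d 1 < d 2` is `Σ_j W(f_j)·∏_{i≠j} f_i²` (✓ `theta_wronskian_prod`).  On a window `0 < u < v` where EVERY row is a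
BACKGROUND row — the pen's three-way menu (val-idea-25 g4, scratch21 `IsBackgroundRow`, stated UNFOLDED here):

* a one-change BINOMIAL on any of the three pairs (`a 2 = 0 ∧ a 0·a 1 < 0`, or `a 0 = 0 ∧ a 1·a 2 < 0`, or `a 1 = 0 ∧ a 0·a 2 < 0`) whose
  root lies outside `[u, v]` (`0 < f(u)·f(v)`);
* an UNSWITCHED INCOHERENT row (`0 < a 0`, `a 1 ≤ 0`, `a 2 ≤ 0`, `a 1 + a 2 < 0`) before its pole (`0 < f(v)`);
* a COHERENT row (`0 < a 0`, `0 < a 1`, `a 2 < 0`) past its pole (`f(u) < 0`);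

every `W(f_j)` is NEGATIVE and no `f_j` vanishes on `(u, v)`, so `W(P) < 0` there and `W(P)` has NO ROOT in the open window
(`background_logWronskian_eval_neg`, ★ `background_logWronskian_roots_eq_zero`; gap-letter forms `…_gaps`).  The per-row signs come from two
exact identities for the `K = 3` row log-Wronskian (`p = d 1 − d 0`, `q = d 2 − d 0`, `r = d 2 − d 1`):
`W(f) = (p² a₁ x^{d₁} + q² a₂ x^{d₂})·f − (p a₁ x^{d₁} + q a₂ x^{d₂})²` and `W(f) = (q² a₀ x^{d₀} + r² a₁ x^{d₁})·f − (q a₀ x^{d₀} + r a₁ x^{d₁})²`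
(`logWronskian_three_eq_top`, `logWronskian_three_eq_bottom`), i.e. «positive row with non-positive tail ⇒ W < 0» and «non-positive
row with positive head ⇒ W < 0» without any monotonicity argument; the binomial case is the single term `(d_l − d_{l'})² a_l a_{l'} x^{d_l+d_{l'}}`.

HONEST FRAMING: ONE no-roots cell of the tropical count (`K_trop = 0`, mixed-rate backgrounds); closes NO stub; `OneChangeFloorK3` /
`WronskianBudgetK3` / `stub_classRowK3` / `stub_polyLaw` / `MatrixDescartes` (18050) OPEN; Conjecture B untouched; `VP ≠ VNP` is NOT proved.
No definitions, no named facts. [folklore]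
-/

set_option linter.dupNamespace false

namespace Summit.ValiantsHypothesis.ValiantsHypothesis.Theorems.LacunarySymmetroidMatrixDescartes

namespace ProductPlusOne

open Polynomial Finset
open scoped BigOperators

/-! ### §1 The `K = 3` row and its log-Wronskian, evaluated -/

/-- The `K = 3` row evaluated: `f(x) = a₀ x^{d₀} + a₁ x^{d₁} + a₂ x^{d₂}`. [folklore] -/
theorem eval_fewnomial_three (d : Fin 3 → ℕ) (a : Fin 3 → ℝ) (x : ℝ) :
    (∑ l, C (a l) * X ^ (d l) : ℝ[X]).eval x = a 0 * x ^ (d 0) + a 1 * x ^ (d 1) + a 2 * x ^ (d 2) := by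
  simp only [Fin.sum_univ_three, eval_add, eval_mul, eval_C, eval_pow, eval_X]

/-- The `K = 3` row log-Wronskian evaluated: the three pair terms `(d_l − d_{l'})² a_l a_{l'} x^{d_l + d_{l'}}`. [folklore] -/
theorem eval_logWronskian_three (d : Fin 3 → ℕ) (a : Fin 3 → ℝ) (x : ℝ) :
    ((∑ l, C (a l) * X ^ (d l) : ℝ[X]) * (X * derivative (X * derivative (∑ l, C (a l) * X ^ (d l) : ℝ[X])))
        - (X * derivative (∑ l, C (a l) * X ^ (d l) : ℝ[X])) ^ 2).eval x
      = ((d 0 : ℝ) - d 1) ^ 2 * (a 0 * a 1) * x ^ (d 0 + d 1) + ((d 0 : ℝ) - d 2) ^ 2 * (a 0 * a 2) * x ^ (d 0 + d 2)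
        + ((d 1 : ℝ) - d 2) ^ 2 * (a 1 * a 2) * x ^ (d 1 + d 2) := by
  rw [eval_logWronskian_fewnomial]
  simp only [Fin.sum_univ_three, sub_self]
  ring

/-- **Identity (top elimination):** `W(f)(x) = (p² a₁ x^{d₁} + q² a₂ x^{d₂})·f(x) − (p a₁ x^{d₁} + q a₂ x^{d₂})²`, `p = d₁ − d₀`, `q = d₂ − d₀`.
[this file's lemma] -/
theorem logWronskian_three_eq_top (d : Fin 3 → ℕ) (a : Fin 3 → ℝ) (x : ℝ) :
    ((∑ l, C (a l) * X ^ (d l) : ℝ[X]) * (X * derivative (X * derivative (∑ l, C (a l) * X ^ (d l) : ℝ[X])))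
        - (X * derivative (∑ l, C (a l) * X ^ (d l) : ℝ[X])) ^ 2).eval x
      = (((d 1 : ℝ) - d 0) ^ 2 * a 1 * x ^ (d 1) + ((d 2 : ℝ) - d 0) ^ 2 * a 2 * x ^ (d 2))
          * (∑ l, C (a l) * X ^ (d l) : ℝ[X]).eval x
        - (((d 1 : ℝ) - d 0) * a 1 * x ^ (d 1) + ((d 2 : ℝ) - d 0) * a 2 * x ^ (d 2)) ^ 2 := by
  rw [eval_logWronskian_three, eval_fewnomial_three]
  ring

/-- **Identity (bottom elimination):** `W(f)(x) = (q² a₀ x^{d₀} + r² a₁ x^{d₁})·f(x) − (q a₀ x^{d₀} + r a₁ x^{d₁})²`, `q = d₂ − d₀`,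
`r = d₂ − d₁`. [this file's lemma] -/
theorem logWronskian_three_eq_bottom (d : Fin 3 → ℕ) (a : Fin 3 → ℝ) (x : ℝ) :
    ((∑ l, C (a l) * X ^ (d l) : ℝ[X]) * (X * derivative (X * derivative (∑ l, C (a l) * X ^ (d l) : ℝ[X])))
        - (X * derivative (∑ l, C (a l) * X ^ (d l) : ℝ[X])) ^ 2).eval x
      = (((d 2 : ℝ) - d 0) ^ 2 * a 0 * x ^ (d 0) + ((d 2 : ℝ) - d 1) ^ 2 * a 1 * x ^ (d 1))
          * (∑ l, C (a l) * X ^ (d l) : ℝ[X]).eval x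
        - (((d 2 : ℝ) - d 0) * a 0 * x ^ (d 0) + ((d 2 : ℝ) - d 1) * a 1 * x ^ (d 1)) ^ 2 := by
  rw [eval_logWronskian_three, eval_fewnomial_three]
  ring

/-! ### §2 Per-row SIGN of the log-Wronskian -/

section RowSigns

variable {d : Fin 3 → ℕ} {a : Fin 3 → ℝ} {x : ℝ}

/-- **Binomial one-change rows have `W < 0`** (any of the three pairs; `x > 0`, distinct exponents). [folklore] -/
theorem logWronskian_three_neg_of_binomial (hd01 : d 0 < d 1) (hd12 : d 1 < d 2) (hx : 0 < x)
    (hb : (a 2 = 0 ∧ a 0 * a 1 < 0) ∨ (a 0 = 0 ∧ a 1 * a 2 < 0) ∨ (a 1 = 0 ∧ a 0 * a 2 < 0)) :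
    ((∑ l, C (a l) * X ^ (d l) : ℝ[X]) * (X * derivative (X * derivative (∑ l, C (a l) * X ^ (d l) : ℝ[X])))
        - (X * derivative (∑ l, C (a l) * X ^ (d l) : ℝ[X])) ^ 2).eval x < 0 := by
  rw [eval_logWronskian_three]
  have h01 : 0 < ((d 0 : ℝ) - d 1) ^ 2 := by
    have : ((d 0 : ℝ) - d 1) ≠ 0 := by
      have : (d 0 : ℝ) < d 1 := by exact_mod_cast hd01
      linarith
    positivity
  have h02 : 0 < ((d 0 : ℝ) - d 2) ^ 2 := by
    have : ((d 0 : ℝ) - d 2) ≠ 0 := by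
      have : (d 0 : ℝ) < d 2 := by exact_mod_cast hd01.trans hd12
      linarith
    positivity
  have h12 : 0 < ((d 1 : ℝ) - d 2) ^ 2 := by
    have : ((d 1 : ℝ) - d 2) ≠ 0 := by
      have : (d 1 : ℝ) < d 2 := by exact_mod_cast hd12
      linarith
    positivity
  have p01 : 0 < x ^ (d 0 + d 1) := pow_pos hx _
  have p02 : 0 < x ^ (d 0 + d 2) := pow_pos hx _
  have p12 : 0 < x ^ (d 1 + d 2) := pow_pos hx _
  rcases hb with ⟨h2, h⟩ | ⟨h0, h⟩ | ⟨h1, h⟩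
  · rw [h2, mul_zero, mul_zero, mul_zero, zero_mul, mul_zero, zero_mul, add_zero, add_zero]
    exact mul_neg_of_neg_of_pos (mul_neg_of_pos_of_neg h01 h) p01
  · rw [h0, zero_mul, zero_mul, mul_zero, zero_mul, mul_zero, zero_mul, zero_add, zero_add]
    exact mul_neg_of_neg_of_pos (mul_neg_of_pos_of_neg h12 h) p12
  · rw [h1, mul_zero, zero_mul, mul_zero, zero_mul, mul_zero, zero_mul, zero_add, add_zero]
    exact mul_neg_of_neg_of_pos (mul_neg_of_pos_of_neg h02 h) p02

/-- **Positive row with non-positive, not-both-zero tail has `W < 0`** (the unswitched incoherent row before its pole), by the top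
elimination identity. [this file's lemma] -/
theorem logWronskian_three_neg_of_pos (hd01 : d 0 < d 1) (hd12 : d 1 < d 2) (hx : 0 < x)
    (h1 : a 1 ≤ 0) (h2 : a 2 ≤ 0) (h12 : a 1 + a 2 < 0) (hf : 0 < (∑ l, C (a l) * X ^ (d l) : ℝ[X]).eval x) :
    ((∑ l, C (a l) * X ^ (d l) : ℝ[X]) * (X * derivative (X * derivative (∑ l, C (a l) * X ^ (d l) : ℝ[X])))
        - (X * derivative (∑ l, C (a l) * X ^ (d l) : ℝ[X])) ^ 2).eval x < 0 := by
  rw [logWronskian_three_eq_top]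
  have hp : 0 < ((d 1 : ℝ) - d 0) := by
    have : (d 0 : ℝ) < d 1 := by exact_mod_cast hd01
    linarith
  have hq : 0 < ((d 2 : ℝ) - d 0) := by
    have : (d 0 : ℝ) < d 2 := by exact_mod_cast hd01.trans hd12
    linarith
  have px1 : 0 < x ^ (d 1) := pow_pos hx _
  have px2 : 0 < x ^ (d 2) := pow_pos hx _
  -- the coefficient `p² a₁ x^{d₁} + q² a₂ x^{d₂}` is negative
  have hcoef : ((d 1 : ℝ) - d 0) ^ 2 * a 1 * x ^ (d 1) + ((d 2 : ℝ) - d 0) ^ 2 * a 2 * x ^ (d 2) < 0 := by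
    have t1 : ((d 1 : ℝ) - d 0) ^ 2 * a 1 * x ^ (d 1) ≤ 0 :=
      mul_nonpos_of_nonpos_of_nonneg (mul_nonpos_of_nonneg_of_nonpos (by positivity) h1) px1.le
    have t2 : ((d 2 : ℝ) - d 0) ^ 2 * a 2 * x ^ (d 2) ≤ 0 :=
      mul_nonpos_of_nonpos_of_nonneg (mul_nonpos_of_nonneg_of_nonpos (by positivity) h2) px2.le
    rcases lt_or_eq_of_le h1 with h1' | h1'
    · have : ((d 1 : ℝ) - d 0) ^ 2 * a 1 * x ^ (d 1) < 0 :=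
        mul_neg_of_neg_of_pos (mul_neg_of_pos_of_neg (by positivity) h1') px1
      linarith
    · have h2' : a 2 < 0 := by linarith
      have : ((d 2 : ℝ) - d 0) ^ 2 * a 2 * x ^ (d 2) < 0 :=
        mul_neg_of_neg_of_pos (mul_neg_of_pos_of_neg (by positivity) h2') px2
      linarith
  nlinarith [mul_neg_of_neg_of_pos hcoef hf,
    sq_nonneg (((d 1 : ℝ) - d 0) * a 1 * x ^ (d 1) + ((d 2 : ℝ) - d 0) * a 2 * x ^ (d 2))]

/-- **Non-positive row with positive head (`0 < a₀`, `0 ≤ a₁`) has `W < 0`** (the coherent row past its pole), by the bottom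
elimination identity. [this file's lemma] -/
theorem logWronskian_three_neg_of_nonpos (hd01 : d 0 < d 1) (hd12 : d 1 < d 2) (hx : 0 < x)
    (h0 : 0 < a 0) (h1 : 0 ≤ a 1) (hf : (∑ l, C (a l) * X ^ (d l) : ℝ[X]).eval x ≤ 0) :
    ((∑ l, C (a l) * X ^ (d l) : ℝ[X]) * (X * derivative (X * derivative (∑ l, C (a l) * X ^ (d l) : ℝ[X])))
        - (X * derivative (∑ l, C (a l) * X ^ (d l) : ℝ[X])) ^ 2).eval x < 0 := by
  rw [logWronskian_three_eq_bottom]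
  have hq : 0 < ((d 2 : ℝ) - d 0) := by
    have : (d 0 : ℝ) < d 2 := by exact_mod_cast hd01.trans hd12
    linarith
  have hr : 0 < ((d 2 : ℝ) - d 1) := by
    have : (d 1 : ℝ) < d 2 := by exact_mod_cast hd12
    linarith
  have px0 : 0 < x ^ (d 0) := pow_pos hx _
  have px1 : 0 < x ^ (d 1) := pow_pos hx _
  have hcoef : 0 ≤ ((d 2 : ℝ) - d 0) ^ 2 * a 0 * x ^ (d 0) + ((d 2 : ℝ) - d 1) ^ 2 * a 1 * x ^ (d 1) := by positivity
  have hsq : 0 < ((d 2 : ℝ) - d 0) * a 0 * x ^ (d 0) + ((d 2 : ℝ) - d 1) * a 1 * x ^ (d 1) := by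
    have : 0 < ((d 2 : ℝ) - d 0) * a 0 * x ^ (d 0) := by positivity
    have : 0 ≤ ((d 2 : ℝ) - d 1) * a 1 * x ^ (d 1) := by positivity
    linarith
  nlinarith [mul_nonpos_of_nonneg_of_nonpos hcoef hf, pow_pos hsq 2]

end RowSigns

/-! ### §3 Rows keep their sign on the window -/

section RowValues

variable {d : Fin 3 → ℕ} {a : Fin 3 → ℝ}

/-- Exponent bookkeeping on `0 < y ≤ z`: `y^n z^m ≤ y^m z^n` for `m ≤ n`. [folklore] -/
theorem pow_mul_pow_le_of_le {y z : ℝ} (hy : 0 < y) (hyz : y ≤ z) {m n : ℕ} (hmn : m ≤ n) :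
    y ^ n * z ^ m ≤ y ^ m * z ^ n := by
  obtain ⟨k, rfl⟩ := Nat.exists_eq_add_of_le hmn
  rw [pow_add, pow_add]
  have hz : 0 < z := lt_of_lt_of_le hy hyz
  have hk : y ^ k ≤ z ^ k := pow_le_pow_left₀ hy.le hyz k
  have : 0 ≤ y ^ m * z ^ m := by positivity
  nlinarith [mul_le_mul_of_nonneg_left hk this]

/-- **An unswitched incoherent row is positive up to `v`:** `0 < a₀`, `a₁, a₂ ≤ 0`, `0 < f(v)`, `0 < x ≤ v` ⇒ `0 < f(x)`. [folklore] -/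
theorem row_three_pos_of_le (hd01 : d 0 < d 1) (hd12 : d 1 < d 2) (h1 : a 1 ≤ 0) (h2 : a 2 ≤ 0)
    {x v : ℝ} (hx : 0 < x) (hxv : x ≤ v) (hv : 0 < (∑ l, C (a l) * X ^ (d l) : ℝ[X]).eval v) :
    0 < (∑ l, C (a l) * X ^ (d l) : ℝ[X]).eval x := by
  rw [eval_fewnomial_three] at hv ⊢
  have hvpos : 0 < v := lt_of_lt_of_le hx hxv
  -- `f(x)·v^{d₀} ≥ x^{d₀}·f(v) > 0`
  have e1 := pow_mul_pow_le_of_le hx hxv (le_of_lt hd01)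
  have e2 := pow_mul_pow_le_of_le hx hxv (le_of_lt (hd01.trans hd12))
  have key : x ^ (d 0) * (a 0 * v ^ (d 0) + a 1 * v ^ (d 1) + a 2 * v ^ (d 2))
      ≤ (a 0 * x ^ (d 0) + a 1 * x ^ (d 1) + a 2 * x ^ (d 2)) * v ^ (d 0) := by
    nlinarith [mul_le_mul_of_nonpos_left e1 h1, mul_le_mul_of_nonpos_left e2 h2]
  have hpos : 0 < x ^ (d 0) * (a 0 * v ^ (d 0) + a 1 * v ^ (d 1) + a 2 * v ^ (d 2)) :=
    mul_pos (pow_pos hx _) hv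
  exact pos_of_mul_pos_left (lt_of_lt_of_le hpos key) (pow_pos hvpos _).le

/-- **A coherent row stays negative past `u`:** `0 < a₀`, `0 < a₁`, `f(u) < 0`, `0 < u ≤ x` ⇒ `f(x) < 0`. [folklore] -/
theorem row_three_neg_of_ge (hd01 : d 0 < d 1) (hd12 : d 1 < d 2) (h0 : 0 < a 0) (h1 : 0 < a 1)
    {u x : ℝ} (hu : 0 < u) (hux : u ≤ x) (hfu : (∑ l, C (a l) * X ^ (d l) : ℝ[X]).eval u < 0) :
    (∑ l, C (a l) * X ^ (d l) : ℝ[X]).eval x < 0 := by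
  rw [eval_fewnomial_three] at hfu ⊢
  have hxpos : 0 < x := lt_of_lt_of_le hu hux
  -- `f(x)·u^{d₂} ≤ x^{d₂}·f(u) < 0`
  have e0 := pow_mul_pow_le_of_le hu hux (le_of_lt (hd01.trans hd12))
  have e1 := pow_mul_pow_le_of_le hu hux (le_of_lt hd12)
  have key : (a 0 * x ^ (d 0) + a 1 * x ^ (d 1) + a 2 * x ^ (d 2)) * u ^ (d 2)
      ≤ x ^ (d 2) * (a 0 * u ^ (d 0) + a 1 * u ^ (d 1) + a 2 * u ^ (d 2)) := by
    nlinarith [mul_le_mul_of_nonneg_left e0 h0.le, mul_le_mul_of_nonneg_left e1 h1.le]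
  have hneg : x ^ (d 2) * (a 0 * u ^ (d 0) + a 1 * u ^ (d 1) + a 2 * u ^ (d 2)) < 0 :=
    mul_neg_of_pos_of_neg (pow_pos hxpos _) hfu
  have hud : 0 < u ^ (d 2) := pow_pos hu _
  by_contra hcon
  push Not at hcon
  have : 0 ≤ (a 0 * x ^ (d 0) + a 1 * x ^ (d 1) + a 2 * x ^ (d 2)) * u ^ (d 2) := mul_nonneg hcon hud.le
  linarith

/-- A two-term function `t ↦ c₀ + c₁ t^k` that vanishes inside `[y, z] ⊂ (0, ∞)` has `g(y)·g(z) ≤ 0` (it is monotone). [folklore] -/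
theorem affinePow_mul_nonpos_of_root (c₀ c₁ : ℝ) (k : ℕ) {y t z : ℝ} (hy : 0 < y) (hyt : y ≤ t) (htz : t ≤ z)
    (ht : c₀ + c₁ * t ^ k = 0) : (c₀ + c₁ * y ^ k) * (c₀ + c₁ * z ^ k) ≤ 0 := by
  have hty : y ^ k ≤ t ^ k := pow_le_pow_left₀ hy.le hyt k
  have htz' : t ^ k ≤ z ^ k := pow_le_pow_left₀ (hy.le.trans hyt) htz k
  rcases le_total 0 c₁ with hc | hc
  · have h1 : c₀ + c₁ * y ^ k ≤ 0 := by nlinarith [mul_le_mul_of_nonneg_left hty hc]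
    have h2 : 0 ≤ c₀ + c₁ * z ^ k := by nlinarith [mul_le_mul_of_nonneg_left htz' hc]
    exact mul_nonpos_of_nonpos_of_nonneg h1 h2
  · have h1 : 0 ≤ c₀ + c₁ * y ^ k := by nlinarith [mul_le_mul_of_nonpos_left hty hc]
    have h2 : c₀ + c₁ * z ^ k ≤ 0 := by nlinarith [mul_le_mul_of_nonpos_left htz' hc]
    exact mul_nonpos_of_nonneg_of_nonpos h1 h2

/-- **A binomial row with `0 < f(u)·f(v)` does not vanish on `[u, v]`** (`0 < u`): the stripped row `c₀ + c₁ x^k` is monotone.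
[folklore] -/
theorem row_three_ne_zero_of_binomial (hd01 : d 0 < d 1) (hd12 : d 1 < d 2)
    (hb : a 2 = 0 ∨ a 0 = 0 ∨ a 1 = 0) {u x v : ℝ} (hu : 0 < u) (hux : u ≤ x) (hxv : x ≤ v)
    (huv : 0 < (∑ l, C (a l) * X ^ (d l) : ℝ[X]).eval u * (∑ l, C (a l) * X ^ (d l) : ℝ[X]).eval v) :
    (∑ l, C (a l) * X ^ (d l) : ℝ[X]).eval x ≠ 0 := by
  intro hx0
  rw [eval_fewnomial_three, eval_fewnomial_three] at huv
  rw [eval_fewnomial_three] at hx0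
  have hx : 0 < x := lt_of_lt_of_le hu hux
  have hv : 0 < v := lt_of_lt_of_le hx hxv
  obtain ⟨p, hp⟩ := Nat.exists_eq_add_of_le (le_of_lt hd01)
  obtain ⟨q, hq⟩ := Nat.exists_eq_add_of_le (le_of_lt (hd01.trans hd12))
  obtain ⟨r, hr⟩ := Nat.exists_eq_add_of_le (le_of_lt hd12)
  rcases hb with h2 | h0 | h1
  · -- `f = x^{d₀} (a₀ + a₁ x^p)`
    have fac : ∀ y : ℝ, a 0 * y ^ (d 0) + a 1 * y ^ (d 1) + a 2 * y ^ (d 2) = y ^ (d 0) * (a 0 + a 1 * y ^ p) := by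
      intro y; rw [h2, hp, pow_add]; ring
    rw [fac] at hx0
    rw [fac, fac] at huv
    have hg : a 0 + a 1 * x ^ p = 0 := by
      rcases mul_eq_zero.1 hx0 with h | h
      · exact absurd h (pow_pos hx _).ne'
      · exact h
    have hle := affinePow_mul_nonpos_of_root (a 0) (a 1) p hu hux hxv hg
    have : u ^ (d 0) * (a 0 + a 1 * u ^ p) * (v ^ (d 0) * (a 0 + a 1 * v ^ p))
        = (u ^ (d 0) * v ^ (d 0)) * ((a 0 + a 1 * u ^ p) * (a 0 + a 1 * v ^ p)) := by ring
    rw [this] at huv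
    have hpos : 0 < u ^ (d 0) * v ^ (d 0) := by positivity
    nlinarith [mul_nonpos_of_nonneg_of_nonpos hpos.le hle]
  · -- `f = x^{d₁} (a₁ + a₂ x^r)`
    have fac : ∀ y : ℝ, a 0 * y ^ (d 0) + a 1 * y ^ (d 1) + a 2 * y ^ (d 2) = y ^ (d 1) * (a 1 + a 2 * y ^ r) := by
      intro y; rw [h0, hr, pow_add]; ring
    rw [fac] at hx0
    rw [fac, fac] at huv
    have hg : a 1 + a 2 * x ^ r = 0 := by
      rcases mul_eq_zero.1 hx0 with h | h
      · exact absurd h (pow_pos hx _).ne'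
      · exact h
    have hle := affinePow_mul_nonpos_of_root (a 1) (a 2) r hu hux hxv hg
    have : u ^ (d 1) * (a 1 + a 2 * u ^ r) * (v ^ (d 1) * (a 1 + a 2 * v ^ r))
        = (u ^ (d 1) * v ^ (d 1)) * ((a 1 + a 2 * u ^ r) * (a 1 + a 2 * v ^ r)) := by ring
    rw [this] at huv
    have hpos : 0 < u ^ (d 1) * v ^ (d 1) := by positivity
    nlinarith [mul_nonpos_of_nonneg_of_nonpos hpos.le hle]
  · -- `f = x^{d₀} (a₀ + a₂ x^q)`
    have fac : ∀ y : ℝ, a 0 * y ^ (d 0) + a 1 * y ^ (d 1) + a 2 * y ^ (d 2) = y ^ (d 0) * (a 0 + a 2 * y ^ q) := by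
      intro y; rw [h1, hq, pow_add]; ring
    rw [fac] at hx0
    rw [fac, fac] at huv
    have hg : a 0 + a 2 * x ^ q = 0 := by
      rcases mul_eq_zero.1 hx0 with h | h
      · exact absurd h (pow_pos hx _).ne'
      · exact h
    have hle := affinePow_mul_nonpos_of_root (a 0) (a 2) q hu hux hxv hg
    have : u ^ (d 0) * (a 0 + a 2 * u ^ q) * (v ^ (d 0) * (a 0 + a 2 * v ^ q))
        = (u ^ (d 0) * v ^ (d 0)) * ((a 0 + a 2 * u ^ q) * (a 0 + a 2 * v ^ q)) := by ring
    rw [this] at huv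
    have hpos : 0 < u ^ (d 0) * v ^ (d 0) := by positivity
    nlinarith [mul_nonpos_of_nonneg_of_nonpos hpos.le hle]

end RowValues

/-! ### §4 The pure background cell -/

section Cell

/-- **A background row on the open window is non-zero with negative log-Wronskian** (the three menu items dispatched to §2–§3).
[this file's lemma] -/
theorem backgroundRow_signs {d : Fin 3 → ℕ} (hd01 : d 0 < d 1) (hd12 : d 1 < d 2) {a : Fin 3 → ℝ} {u v : ℝ} (hu : 0 < u)
    (hrow : ((((a 2 = 0 ∧ a 0 * a 1 < 0) ∨ (a 0 = 0 ∧ a 1 * a 2 < 0) ∨ (a 1 = 0 ∧ a 0 * a 2 < 0)) ∧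
          0 < (∑ l, C (a l) * X ^ (d l) : ℝ[X]).eval u * (∑ l, C (a l) * X ^ (d l) : ℝ[X]).eval v) ∨
        (0 < a 0 ∧ a 1 ≤ 0 ∧ a 2 ≤ 0 ∧ a 1 + a 2 < 0 ∧ 0 < (∑ l, C (a l) * X ^ (d l) : ℝ[X]).eval v) ∨
        (0 < a 0 ∧ 0 < a 1 ∧ a 2 < 0 ∧ (∑ l, C (a l) * X ^ (d l) : ℝ[X]).eval u < 0)))
    {x : ℝ} (hux : u < x) (hxv : x < v) :
    (∑ l, C (a l) * X ^ (d l) : ℝ[X]).eval x ≠ 0 ∧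
      ((∑ l, C (a l) * X ^ (d l) : ℝ[X]) * (X * derivative (X * derivative (∑ l, C (a l) * X ^ (d l) : ℝ[X])))
          - (X * derivative (∑ l, C (a l) * X ^ (d l) : ℝ[X])) ^ 2).eval x < 0 := by
  have hx : 0 < x := hu.trans hux
  rcases hrow with ⟨hb, huv⟩ | ⟨_, h1, h2, h12, hv⟩ | ⟨h0, h1, _, hfu⟩
  · refine ⟨row_three_ne_zero_of_binomial hd01 hd12 ?_ hu hux.le hxv.le huv,
      logWronskian_three_neg_of_binomial hd01 hd12 hx hb⟩
    rcases hb with ⟨h, -⟩ | ⟨h, -⟩ | ⟨h, -⟩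
    exacts [Or.inl h, Or.inr (Or.inl h), Or.inr (Or.inr h)]
  · have hf := row_three_pos_of_le hd01 hd12 h1 h2 hx hxv.le hv
    exact ⟨hf.ne', logWronskian_three_neg_of_pos hd01 hd12 hx h1 h2 h12 hf⟩
  · have hf := row_three_neg_of_ge hd01 hd12 h0 h1 hu hux.le hfu
    exact ⟨hf.ne, logWronskian_three_neg_of_nonpos hd01 hd12 hx h0 h1.le hf.le⟩

/-- **THE PURE BACKGROUND CELL, pointwise:** on the open window the company log-Wronskian of `m ≥ 1` background rows is NEGATIVE
(`W(∏ f_j) = Σ_j W(f_j)·∏_{i≠j} f_i²`, ✓ `theta_wronskian_prod`, every summand `< 0`). [this file's theorem] -/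
theorem background_logWronskian_eval_neg {m : ℕ} (hm : 0 < m) (d : Fin 3 → ℕ) (hd01 : d 0 < d 1) (hd12 : d 1 < d 2)
    (a : Fin m → Fin 3 → ℝ) {u v : ℝ} (hu : 0 < u)
    (hrow : ∀ j, ((((a j 2 = 0 ∧ a j 0 * a j 1 < 0) ∨ (a j 0 = 0 ∧ a j 1 * a j 2 < 0) ∨ (a j 1 = 0 ∧ a j 0 * a j 2 < 0)) ∧
          0 < (∑ l, C (a j l) * X ^ (d l) : ℝ[X]).eval u * (∑ l, C (a j l) * X ^ (d l) : ℝ[X]).eval v) ∨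
        (0 < a j 0 ∧ a j 1 ≤ 0 ∧ a j 2 ≤ 0 ∧ a j 1 + a j 2 < 0 ∧ 0 < (∑ l, C (a j l) * X ^ (d l) : ℝ[X]).eval v) ∨
        (0 < a j 0 ∧ 0 < a j 1 ∧ a j 2 < 0 ∧ (∑ l, C (a j l) * X ^ (d l) : ℝ[X]).eval u < 0)))
    {x : ℝ} (hux : u < x) (hxv : x < v) :
    ((∏ j, (∑ l, C (a j l) * X ^ (d l) : ℝ[X])) * (X * derivative (X * derivative (∏ j, (∑ l, C (a j l) * X ^ (d l) : ℝ[X]))))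
        - (X * derivative (∏ j, (∑ l, C (a j l) * X ^ (d l) : ℝ[X]))) ^ 2).eval x < 0 := by
  rw [theta_wronskian_prod, eval_finsetSum]
  refine Finset.sum_neg (fun j _ => ?_) ⟨⟨0, hm⟩, Finset.mem_univ _⟩
  rw [eval_mul, eval_prod]
  refine mul_neg_of_neg_of_pos (backgroundRow_signs hd01 hd12 hu (hrow j) hux hxv).2
    (Finset.prod_pos fun i _ => ?_)
  have hi := (backgroundRow_signs hd01 hd12 hu (hrow i) hux hxv).1
  rw [eval_pow]
  positivity

/-- ★ **THE PURE BACKGROUND CELL (`BackgroundCellK3`, memo §21 (E6-C0)):** `K = 3`, common support `d 0 < d 1 < d 2`, any number `m` of rows,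
window `0 < u`; if EVERY row is a background row — a one-change binomial (any pair) with `0 < f(u)·f(v)`, an unswitched incoherent row
with `0 < f(v)`, or a coherent row with `f(u) < 0` — then `W(∏_j f_j)` has NO ROOT in the open window `(u, v)`. [this file's theorem] -/
theorem background_logWronskian_roots_eq_zero {m : ℕ} (d : Fin 3 → ℕ) (hd01 : d 0 < d 1) (hd12 : d 1 < d 2)
    (a : Fin m → Fin 3 → ℝ) {u v : ℝ} (hu : 0 < u)
    (hrow : ∀ j, ((((a j 2 = 0 ∧ a j 0 * a j 1 < 0) ∨ (a j 0 = 0 ∧ a j 1 * a j 2 < 0) ∨ (a j 1 = 0 ∧ a j 0 * a j 2 < 0)) ∧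
          0 < (∑ l, C (a j l) * X ^ (d l) : ℝ[X]).eval u * (∑ l, C (a j l) * X ^ (d l) : ℝ[X]).eval v) ∨
        (0 < a j 0 ∧ a j 1 ≤ 0 ∧ a j 2 ≤ 0 ∧ a j 1 + a j 2 < 0 ∧ 0 < (∑ l, C (a j l) * X ^ (d l) : ℝ[X]).eval v) ∨
        (0 < a j 0 ∧ 0 < a j 1 ∧ a j 2 < 0 ∧ (∑ l, C (a j l) * X ^ (d l) : ℝ[X]).eval u < 0))) :
    ((((∏ j, (∑ l, C (a j l) * X ^ (d l) : ℝ[X])) * (X * derivative (X * derivative (∏ j, (∑ l, C (a j l) * X ^ (d l) : ℝ[X]))))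
        - (X * derivative (∏ j, (∑ l, C (a j l) * X ^ (d l) : ℝ[X]))) ^ 2)).roots.toFinset.filter
        (fun t => u < t ∧ t < v)).card = 0 := by
  rw [Finset.card_eq_zero, Finset.filter_eq_empty_iff]
  rintro t ht ⟨hut, htv⟩
  rw [Multiset.mem_toFinset, Polynomial.mem_roots'] at ht
  obtain ⟨hne, hroot⟩ := ht
  rcases Nat.eq_zero_or_pos m with rfl | hm
  · apply hne
    simp
  · exact (background_logWronskian_eval_neg hm d hd01 hd12 a hu hrow hut htv).ne hroot

/-- ★ **The pure background cell in GAP LETTERS** (`d 1 = d 0 + e₁ + 1`, `d 2 = d 1 + e₂ + 1`, the LINE's wiring). [this file's theorem] -/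
theorem background_logWronskian_roots_eq_zero_gaps {m : ℕ} (d : Fin 3 → ℕ) (e₁ e₂ : ℕ) (he₁ : d 1 = d 0 + e₁ + 1)
    (he₂ : d 2 = d 1 + e₂ + 1) (a : Fin m → Fin 3 → ℝ) {u v : ℝ} (hu : 0 < u)
    (hrow : ∀ j, ((((a j 2 = 0 ∧ a j 0 * a j 1 < 0) ∨ (a j 0 = 0 ∧ a j 1 * a j 2 < 0) ∨ (a j 1 = 0 ∧ a j 0 * a j 2 < 0)) ∧
          0 < (∑ l, C (a j l) * X ^ (d l) : ℝ[X]).eval u * (∑ l, C (a j l) * X ^ (d l) : ℝ[X]).eval v) ∨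
        (0 < a j 0 ∧ a j 1 ≤ 0 ∧ a j 2 ≤ 0 ∧ a j 1 + a j 2 < 0 ∧ 0 < (∑ l, C (a j l) * X ^ (d l) : ℝ[X]).eval v) ∨
        (0 < a j 0 ∧ 0 < a j 1 ∧ a j 2 < 0 ∧ (∑ l, C (a j l) * X ^ (d l) : ℝ[X]).eval u < 0))) :
    ((((∏ j, (∑ l, C (a j l) * X ^ (d l) : ℝ[X])) * (X * derivative (X * derivative (∏ j, (∑ l, C (a j l) * X ^ (d l) : ℝ[X]))))
        - (X * derivative (∏ j, (∑ l, C (a j l) * X ^ (d l) : ℝ[X]))) ^ 2)).roots.toFinset.filter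
        (fun t => u < t ∧ t < v)).card = 0 :=
  background_logWronskian_roots_eq_zero d (by omega) (by omega) a hu hrow

end Cell

end ProductPlusOne

end Summit.ValiantsHypothesis.ValiantsHypothesis.Theorems.LacunarySymmetroidMatrixDescartes
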